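import Summits.BirchSwinnertonDyer.BirchSwinnertonDyer.Theses.SignedLowerHalves
import Summits.BirchSwinnertonDyer.BirchSwinnertonDyer.Theorems.PrintX8VSCInputHondaSystem
import HarnessLib

/-! # K3 `SignedLowerHalves` rev 23 — the by-name aside twin `InputHondaSystem` (item stmt-BirchSwinnertonDyer-23868), closed
K3 twin of PrintX8VSC's CLOSED aside 23750 (Sprung 2012 Thm 2.2 / Kobayashi 2003 §8 Honda system; p676554). No crux / summit / BSD proved. -/

set_option autoImplicit false
-- justification: the mandated namespace `Summit.BirchSwinnertonDyer.BirchSwinnertonDyer.Theorems`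
-- (single-conjunct summit, Sub = Summit) repeats a segment by design (D-0017).
set_option linter.dupNamespace false

namespace Summit.BirchSwinnertonDyer.BirchSwinnertonDyer.Theorems.SignedLowerHalvesPrintX8Links

/-- item stmt-BirchSwinnertonDyer-23868 closed by name (K3 twin of PrintX8VSC aside 23750, p676554). -/
theorem inputHondaSystem_holds :
    Summit.BirchSwinnertonDyer.BirchSwinnertonDyer.Theses.SignedLowerHalves.InputHondaSystem :=
  Summit.BirchSwinnertonDyer.BirchSwinnertonDyer.Theorems.PrintX8VSCGlue.inputHondaSystem_holds

end Summit.BirchSwinnertonDyer.BirchSwinnertonDyer.Theorems.SignedLowerHalvesPrintX8Links
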